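import Summits.QuantumFields.BalabanUV.T4Continuum.Support.NE3QbarIterNearFlat
import Summits.QuantumFields.BalabanUV.T4Continuum.Support.NE3QbarGaugeCovariance
import Summits.QuantumFields.BalabanUV.T4Continuum.Support.NE3SmoothRightInverseFlat
import Summits.QuantumFields.BalabanUV.T4Continuum.Support.NE7CutoffLeibniz
import Summits.QuantumFields.BalabanUV.T4Continuum.Support.SpreadLiftDirection
import Summits.QuantumFields.BalabanUV.T4Continuum.Support.BlockAverageCurrent
import HarnessLib

/-!
# NE7LocalStraightDatumLetter — (C2) THE LOCAL STRAIGHT-DATUM LETTER: for a `Q̄_W`-TANGENT `Y`, a unitary site gauge `u` and a real cut-off `χ`, the FLAT iterated average of the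
# cut-off gauged field is small — `‖QbarIter L (k+1) flat (χ•Y^u) z κ‖ ≤ M·ω·S + |χ(M•z)|·2L^k S·Σ_{i≤k}((2d+4)L²δ_i + (8L + C_sup)·loopRad(x_i))`, `M = L^{k+1}`,
# where `ω` = oscillation of `χ` on the straight-average region of `z`, `S = sup‖Y‖`, and `δ_i = L^iδ + 4Σ_{i′<i}L^{i−1−i′}loopRad(x_{i′})` from `‖W^u − 1‖ ≤ δ` on the fine ball of `z`
# (memo ROAD-G100 §4; NAMED ASK (C2) of t4-ne7-p1 g101, INBOX L.2493)

Cell `pub-balaban`, rung (B)+1 sub-cell t4, lineage `b2b-balaban-t4-ne7b-p1`, generation 150 (OWNER of BINDER row NE7b; junction service for the NE crew, ruling R-OWNER-149-1 (2)).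
A JUNCTION for row NE7 (node U5), asked by name by the road owner t4-ne7-p1 g101 ([NE7P1-G101-INBOX-1]): in the bootstrap for the curved sup letter (L) of `𝒯_E(W)` the slice
element `Y` (`QbarIter L (k+1) W Y = 0`) is gauged by the comb `u` (`W′ := W^u` is `δ`-close to `1` on a box), cut off by `χ` and transplanted onto a flat torus; the engine
`NE7FlatSupLetterGeneral.sup_flat_general` then needs a bound on the STRAIGHT datum `w ≥ ‖QbarIter L (k+1) 1 (χ•Y′)‖`.  THIS FILE: (i) at the flat background the iterated average
IS the one-shot straight average with block `M = L^{k+1}` (`NE3TangentCovariantTower.QbarIter_flat`, `NE3SmoothRightInverseFlat.iterate_Qcoarse_apply`), so the cut-off commutator is ONE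
application of `NE7CutoffLeibniz.norm_linQ_smul_fun_sub_le`: `‖linQ M (χ•Y′)(M•z) − χ(M•z)•linQ M Y′ (M•z)‖ ≤ M·ω·S`; (ii) `linQ M Y′ (M•z) κ = linQIter L Y′ (k+1) z κ`
(`B7Prop4Flat.linQIter_eq_linQ_pow`) is compared with the CURVED average at `W′` by row NE3's near-identity tower `NE3QbarIterNearFlat.norm_QbarIter_sub_linQIter_le` (with
`norm_cavgIter_sub_one_le_tower`, `norm_QbarIter_le_two_mul` feeding its two families; `L ≥ 2`), and (iii) the curved average of the gauged field VANISHES by covariance,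
`NE3QbarGaugeCovariance.QbarIter_gaugeAct`: `QbarIter W′ Y′ = Ad(u(M•(z+e_κ)))·QbarIter W Y = 0`.
WHAT ([folklore]; 0 def, 0 sorry; every `d`; multi-level small-field class at `W`, `L ≥ 2`; `Y′ := fun y μ ⇒ Ad (u (y + e_μ)) (Y y μ)` = `AveragingDeficitLocality.dirGauge u Y`).
§1 `QbarIter_flat_eq_linQ` (`QbarIter L (k+1) flat F z κ = linQ (L^{k+1}) F (L^{k+1}•z) κ`), `linQIter_eq_QbarIter_flat`, `norm_dirGauge_le` (`‖Y′‖ ≤ S`),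
   **`cutoff_commutator_flat`** (`‖QbarIter flat (χ•F) z κ − χ(M•z)•QbarIter flat F z κ‖ ≤ M·(ω·S)` — W-free, any `F` with `‖F‖ ≤ S`).
§2 **`norm_linQIter_gauged_le`** (THE CURVED HALF: in the class, `u` unitary, `QbarIter L (k+1) W Y z κ = 0`, `‖Y‖ ≤ S`, `‖W^u − 1‖ ≤ δ` on the fine ball
   `{x′ : |x′ − M•z|₁ ≤ nbRad·Σ_{i≤k}L^i}` ⟹ `‖linQIter L Y′ (k+1) z κ‖ ≤ 2L^k S·Σ_{i<k+1}((2d+4)L²·δ_i + (8L + C_sup)·loopRad d L (x_i))`).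
§3 **`local_straight_datum_letter`** ((C2) as asked: the sum of §1 and §2, the curved half weighted by `|χ(M•z)| ≤ 1`), **`local_straight_datum_letter_off_support`** (`χ(M•z) = 0`: only
   the commutator term `M·ω·S` — no near-flatness needed).
§4 (v2 APPEND) `abs_sub_le_mul_of_supStep` (sup-step `g`-Lipschitz ⟹ `|χ x − χ y| ≤ N·g` when every `|x_j − y_j| ≤ N`), `osc_region_of_supStep` (the region's oscillation is `≤ 2(M−1)·g`),
   **`local_straight_datum_letter_of_supStep`** ((C2) with `hω` replaced by the sup-step hypothesis of `AveragingDeficitLatticeH2Prep.abs_chi_sub_chi_le_of_step`: commutator term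
   `M·(2(M−1)·g·S)`, `= 2M(M−1)S∕M′` for `chi R M′ z₀`).
HONEST FRAMING (page 1): bookkeeping over row NE3's landed tower letters and gen 150's Leibniz rule, BY NAME; every constant is the tree's; nothing of Bałaban's asserted; NOT the curved
letter (L) (its assembly (E) and periodisation (C1) are the road's), NOT (S1), NOT NE7, nothing of row NE7b; spine 0∕9; finite T⁴ rung (B)+1 — NOT infinite volume, NOT mass gap, NOT
BetaPertH, NOT Clay.  Continuum YM on T⁴ ⇐ BetaPertH ∧ nine spine estimates (0/9 proved); BetaPertH ⇐ (D1) ∧ (D4) ∧ CAP+tail; G-an2-4 gates asym, D1 and NE2/3/4.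
-/

set_option autoImplicit false

open scoped BigOperators Matrix.Norms.L2Operator
open Finset

namespace Summit.QuantumFields.BalabanUV.T4Continuum.NE7LocalStraightDatumLetter

open Literature.MathematicalPhysics.QuantumFieldTheory.Balaban1983to89
open B7Prop1Explicit B7Prop2Explicit
open B7Prop3Flat (linQ)
open B7Prop4Flat (linQIter linQIter_eq_linQ_pow)
open T4AveragingDeficitWall (IsUnitaryCfg SmallField Ad)
open AveragingDeficitTransport (norm_Ad_of_unitary)
open AveragingDeficitNearIdentity (Ad_zero)
open AveragingDeficitMultiLevelPrep (LevelSmall)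
open AveragingDeficitTwoLevelPrep (prop1Radius)
open SpreadLift (loopRad)
open BlockAverageVaryHolo (nbRad)
open BlockAveragePushDirSplit (flat)
open NE3TangentFlatStructure (Qcoarse)
open NE3TangentCovariantTower (QbarIter QbarIter_flat)
open NE3SmoothRightInverseFlat (iterate_Qcoarse_apply)
open NE3CovariantLineSumsError (Csup)
open NE3QbarIterNearFlat (norm_QbarIter_sub_linQIter_le norm_cavgIter_sub_one_le_tower norm_QbarIter_le_two_mul)
open NE3QbarGaugeCovariance (QbarIter_gaugeAct)
open NE7CutoffLeibniz (norm_linQ_smul_fun_sub_le)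
open SpreadLiftDirection (isUnitaryCfg_gaugeAct')
open BlockAverageCurrent (smallField_gaugeAct)

noncomputable section

variable {d : ℕ} {n : Type*} [Fintype n] [DecidableEq n]

/-! ## §1 The flat side: the iterated flat average is one straight average; the cut-off commutator -/

/-- At the flat background the `(k+1)`-fold linearised average is ONE straight average with block `L^{k+1}`: `QbarIter L (k+1) flat F z κ = linQ (L^{k+1}) F (L^{k+1}•z) κ` (`L ≥ 1`).
[folklore] -/
theorem QbarIter_flat_eq_linQ {L : ℕ} (hL : 1 ≤ L) (k : ℕ) (F : Site d → Fin d → Matrix n n ℂ) (z : Site d) (κ : Fin d) :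
    QbarIter L (k + 1) (flat (d := d) (n := n)) F z κ = linQ (L ^ (k + 1)) F (((L ^ (k + 1) : ℕ) : ℤ) • z) κ := by
  rw [QbarIter_flat hL (k + 1) F, iterate_Qcoarse_apply]

/-- … and the flat tower `linQIter` is the same straight average: `linQIter L F (k+1) z κ = QbarIter L (k+1) flat F z κ`. [folklore] -/
theorem linQIter_eq_QbarIter_flat {L : ℕ} (hL : 1 ≤ L) (k : ℕ) (F : Site d → Fin d → Matrix n n ℂ) (z : Site d) (κ : Fin d) :
    linQIter L F (k + 1) z κ = QbarIter L (k + 1) (flat (d := d) (n := n)) F z κ := by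
  rw [QbarIter_flat_eq_linQ hL, linQIter_eq_linQ_pow]

/-- The gauged direction `Y′(y,μ) = Ad_{u(y+e_μ)} Y(y,μ)` has the same bond norms (unitary `u`). [folklore] -/
theorem norm_dirGauge_le {u : Site d → (Matrix n n ℂ)ˣ} (hu : ∀ y, u y ∈ unitaryUnits (Matrix n n ℂ)) (Y : Site d → Fin d → Matrix n n ℂ) {S : ℝ}
    (hS : ∀ y μ, ‖Y y μ‖ ≤ S) (y : Site d) (μ : Fin d) : ‖Ad (u (y + e μ)) (Y y μ)‖ ≤ S := by
  rw [norm_Ad_of_unitary (hu _)]; exact hS y μ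

/-- **THE CUT-OFF COMMUTATOR OF THE FLAT ITERATED AVERAGE** (W-free; `L ≥ 1`, `M := L^{k+1}`): for any `F` with `‖F‖ ≤ S` and a real `χ` whose oscillation on the straight-average
region of `z` (the `κ`-lines of length `2M − 1` issuing from the block `[M•z, M•z + (M−1)]`) around the value `t` is `≤ ω`:
`‖QbarIter flat (χ•F) z κ − t•QbarIter flat F z κ‖ ≤ M·(ω·S)`. [folklore] -/
theorem cutoff_commutator_flat {L : ℕ} (hL : 1 ≤ L) (k : ℕ) (χ : Site d → ℝ) (t : ℝ) (F : Site d → Fin d → Matrix n n ℂ) (z : Site d) (κ : Fin d)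
    {ω S : ℝ} (hS : ∀ y μ, ‖F y μ‖ ≤ S)
    (hω : ∀ x' : Site d, (((L ^ (k + 1) : ℕ) : ℤ) • z) ≤ x' → (∀ i, i ≠ κ → x' i ≤ ((((L ^ (k + 1) : ℕ) : ℤ) • z) i) + (((L ^ (k + 1) : ℕ) : ℤ) - 1)) →
      x' κ ≤ ((((L ^ (k + 1) : ℕ) : ℤ) • z) κ) + 2 * (((L ^ (k + 1) : ℕ) : ℤ) - 1) → |χ x' - t| ≤ ω) :
    ‖QbarIter L (k + 1) (flat (d := d) (n := n)) (fun y μ => χ y • F y μ) z κ - t • QbarIter L (k + 1) (flat (d := d) (n := n)) F z κ‖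
      ≤ ((L ^ (k + 1) : ℕ) : ℝ) * (ω * S) := by
  have hM : 1 ≤ L ^ (k + 1) := Nat.one_le_pow _ _ hL
  rw [QbarIter_flat_eq_linQ hL, QbarIter_flat_eq_linQ hL]
  exact norm_linQ_smul_fun_sub_le hM χ t F _ κ hω (fun x' _ _ _ => hS x' κ)

/-! ## §2 The curved side: the straight average of the gauged tangent field is small near a `δ`-flat gauged background -/

section Curved

variable [Nonempty n] {L : ℕ} (hL : 2 ≤ L) (k : ℕ) {W : Site d → Fin d → (Matrix n n ℂ)ˣ} {x : ℝ}
  (hWu : IsUnitaryCfg W) (hx : 0 ≤ x) (hs : LevelSmall d L k x) (hWx : SmallField W x)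
  {u : Site d → (Matrix n n ℂ)ˣ} (hu : ∀ y, u y ∈ unitaryUnits (Matrix n n ℂ))

include hL hWu hx hs hWx hu in
/-- **THE STRAIGHT AVERAGE OF THE GAUGED TANGENT FIELD** (multi-level small-field class at `W`, `L ≥ 2`, unitary `u`; `M = L^{k+1}`, `Y′ = Ad_{u(·+e_μ)}Y`): if
`QbarIter L (k+1) W Y z κ = 0`, `‖Y‖ ≤ S`, and the gauged background `W^u` is `δ`-close to `1` on the fine ball `{x′ : |x′ − M•z|₁ ≤ nbRad·Σ_{i<k+1}L^i}`, then
`‖linQIter L Y′ (k+1) z κ‖ ≤ 2L^k·S·Σ_{i<k+1}((2d+4)L²·δ_i + (8L + C_sup)·loopRad d L (x_i))`, `δ_i := L^i·δ + 4Σ_{i′<i}L^{i−1−i′}loopRad d L (x_{i′})`, `x_i := prop1Radius^[i] x`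
— because the CURVED average of `Y′` at `W^u` vanishes by covariance and differs from the straight one by the near-identity tower. [folklore] -/
theorem norm_linQIter_gauged_le (Y : Site d → Fin d → Matrix n n ℂ) (z : Site d) (κ : Fin d) (hY0 : QbarIter L (k + 1) W Y z κ = 0)
    {S δ : ℝ} (hS0 : 0 ≤ S) (hS : ∀ y μ, ‖Y y μ‖ ≤ S)
    (hδ : ∀ (x' : Site d) (μ : Fin d), l1 (x' - ((L : ℤ) ^ (k + 1)) • z) ≤ nbRad d L * ∑ i ∈ Finset.range (k + 1), L ^ i →
      ‖((gaugeAct u W x' μ : (Matrix n n ℂ)ˣ) : Matrix n n ℂ) - 1‖ ≤ δ) :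
    ‖linQIter L (fun y μ => Ad (u (y + e μ)) (Y y μ)) (k + 1) z κ‖
      ≤ (L : ℝ) ^ k * (2 * S) * ∑ i ∈ Finset.range (k + 1),
          ((2 * (d : ℝ) + 4) * (L : ℝ) ^ 2 * ((L : ℝ) ^ i * δ + 4 * ∑ i' ∈ Finset.range i, (L : ℝ) ^ (i - 1 - i') * loopRad d L ((prop1Radius d L)^[i'] x))
            + (8 * (L : ℝ) + Csup d L) * loopRad d L ((prop1Radius d L)^[i] x)) := by
  have hL1 : 1 ≤ L := le_trans one_le_two hL
  have hW'u : IsUnitaryCfg (gaugeAct u W) := isUnitaryCfg_gaugeAct' hu hWu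
  have hW'x : SmallField (gaugeAct u W) x := smallField_gaugeAct hu hWx
  set Y' : Site d → Fin d → Matrix n n ℂ := fun y μ => Ad (u (y + e μ)) (Y y μ) with hY'
  have hS' : ∀ y μ, ‖Y' y μ‖ ≤ S := fun y μ => norm_dirGauge_le hu Y hS y μ
  -- covariance: the curved average of `Y′` at `W^u` vanishes at `(z, κ)`
  have hcov : QbarIter L (k + 1) (gaugeAct u W) Y' z κ = 0 := by
    have h := congrFun (congrFun (QbarIter_gaugeAct hL1 k hWu hx hs hWx hu Y) z) κ
    rw [hY', h, hY0, Ad_zero]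
  -- the two families of the near-identity tower at `W^u`
  have ha := norm_cavgIter_sub_one_le_tower hL1 k hW'u hx hs hW'x z hδ
  have hb : ∀ (i m : ℕ), i + m = k → ∀ (y : Site d) (μ : Fin d),
      l1 (y - ((L : ℤ) ^ (m + 1)) • z) ≤ nbRad d L * ∑ i ∈ Finset.range (m + 1), L ^ i →
      ‖QbarIter L i (gaugeAct u W) Y' y μ‖ ≤ (L : ℝ) ^ i * (2 * S) := by
    intro i m him y μ hy
    have h := norm_QbarIter_le_two_mul hL k hW'u hx hs hW'x Y' z hS0 (fun x' μ' _ => hS' x' μ') i (m + 1) (by omega) y μ hy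
    linarith
  have hc : ∀ (y : Site d) (μ : Fin d), l1 (y - ((L : ℤ) ^ (k + 1)) • z) ≤ nbRad d L * ∑ i ∈ Finset.range (k + 1), L ^ i →
      ‖Y' y μ - Y' y μ‖ ≤ 0 := fun y μ _ => by rw [sub_self, norm_zero]
  have htower := norm_QbarIter_sub_linQIter_le hL1 k hW'u hx hs hW'x Y' Y' z κ
    (ŝ := 2 * S) (e := 0) (fun i => (L : ℝ) ^ i * δ + 4 * ∑ i' ∈ Finset.range i, (L : ℝ) ^ (i - 1 - i') * loopRad d L ((prop1Radius d L)^[i'] x))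
    (fun i m him y μ hy => ha i (m + 1) (by omega) y μ hy) hb hc
  rw [hcov, zero_sub, norm_neg, mul_zero, zero_add] at htower
  exact htower

end Curved

/-! ## §3 (C2) assembled -/

section Assembled

variable [Nonempty n] {L : ℕ} (hL : 2 ≤ L) (k : ℕ) {W : Site d → Fin d → (Matrix n n ℂ)ˣ} {x : ℝ}
  (hWu : IsUnitaryCfg W) (hx : 0 ≤ x) (hs : LevelSmall d L k x) (hWx : SmallField W x)
  {u : Site d → (Matrix n n ℂ)ˣ} (hu : ∀ y, u y ∈ unitaryUnits (Matrix n n ℂ))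

include hL hWu hx hs hWx hu in
/-- **(C2) THE LOCAL STRAIGHT-DATUM LETTER** (multi-level small-field class at `W`, `L ≥ 2`, unitary `u`, `M = L^{k+1}`, `Y′ = Ad_{u(·+e_μ)}Y`): if `QbarIter L (k+1) W Y z κ = 0`,
`‖Y‖ ≤ S`, `|χ(M•z)| ≤ 1`, the oscillation of `χ` around `χ(M•z)` on the straight-average region of `(z, κ)` is `≤ ω`, and `‖W^u − 1‖ ≤ δ` on the fine ball of `z`, then
`‖QbarIter L (k+1) flat (χ•Y′) z κ‖ ≤ M·(ω·S) + 2L^k·S·Σ_{i<k+1}((2d+4)L²·δ_i + (8L + C_sup)·loopRad d L (x_i))`. [folklore] -/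
theorem local_straight_datum_letter (Y : Site d → Fin d → Matrix n n ℂ) (χ : Site d → ℝ) (z : Site d) (κ : Fin d)
    (hY0 : QbarIter L (k + 1) W Y z κ = 0) {S ω δ : ℝ} (hS0 : 0 ≤ S) (hS : ∀ y μ, ‖Y y μ‖ ≤ S)
    (hχ1 : |χ (((L ^ (k + 1) : ℕ) : ℤ) • z)| ≤ 1)
    (hω : ∀ x' : Site d, (((L ^ (k + 1) : ℕ) : ℤ) • z) ≤ x' → (∀ i, i ≠ κ → x' i ≤ ((((L ^ (k + 1) : ℕ) : ℤ) • z) i) + (((L ^ (k + 1) : ℕ) : ℤ) - 1)) →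
      x' κ ≤ ((((L ^ (k + 1) : ℕ) : ℤ) • z) κ) + 2 * (((L ^ (k + 1) : ℕ) : ℤ) - 1) → |χ x' - χ (((L ^ (k + 1) : ℕ) : ℤ) • z)| ≤ ω)
    (hδ : ∀ (x' : Site d) (μ : Fin d), l1 (x' - ((L : ℤ) ^ (k + 1)) • z) ≤ nbRad d L * ∑ i ∈ Finset.range (k + 1), L ^ i →
      ‖((gaugeAct u W x' μ : (Matrix n n ℂ)ˣ) : Matrix n n ℂ) - 1‖ ≤ δ) :
    ‖QbarIter L (k + 1) (flat (d := d) (n := n)) (fun y μ => χ y • Ad (u (y + e μ)) (Y y μ)) z κ‖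
      ≤ ((L ^ (k + 1) : ℕ) : ℝ) * (ω * S)
        + (L : ℝ) ^ k * (2 * S) * ∑ i ∈ Finset.range (k + 1),
          ((2 * (d : ℝ) + 4) * (L : ℝ) ^ 2 * ((L : ℝ) ^ i * δ + 4 * ∑ i' ∈ Finset.range i, (L : ℝ) ^ (i - 1 - i') * loopRad d L ((prop1Radius d L)^[i'] x))
            + (8 * (L : ℝ) + Csup d L) * loopRad d L ((prop1Radius d L)^[i] x)) := by
  have hL1 : 1 ≤ L := le_trans one_le_two hL
  set Y' : Site d → Fin d → Matrix n n ℂ := fun y μ => Ad (u (y + e μ)) (Y y μ) with hY'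
  have hS' : ∀ y μ, ‖Y' y μ‖ ≤ S := fun y μ => norm_dirGauge_le hu Y hS y μ
  set t : ℝ := χ (((L ^ (k + 1) : ℕ) : ℤ) • z) with ht
  have hcomm := cutoff_commutator_flat hL1 k χ t Y' z κ hS' hω
  have hcurv := norm_linQIter_gauged_le hL k hWu hx hs hWx hu Y z κ hY0 hS0 hS hδ
  rw [linQIter_eq_QbarIter_flat hL1] at hcurv
  have e : QbarIter L (k + 1) (flat (d := d) (n := n)) (fun y μ => χ y • Y' y μ) z κ
      = (QbarIter L (k + 1) (flat (d := d) (n := n)) (fun y μ => χ y • Y' y μ) z κ - t • QbarIter L (k + 1) (flat (d := d) (n := n)) Y' z κ)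
        + t • QbarIter L (k + 1) (flat (d := d) (n := n)) Y' z κ := by rw [sub_add_cancel]
  rw [e]
  calc ‖QbarIter L (k + 1) flat (fun y μ => χ y • Y' y μ) z κ - t • QbarIter L (k + 1) flat Y' z κ + t • QbarIter L (k + 1) flat Y' z κ‖
      ≤ ‖QbarIter L (k + 1) flat (fun y μ => χ y • Y' y μ) z κ - t • QbarIter L (k + 1) flat Y' z κ‖ + ‖t • QbarIter L (k + 1) flat Y' z κ‖ := norm_add_le _ _
    _ ≤ ((L ^ (k + 1) : ℕ) : ℝ) * (ω * S) + 1 * ‖QbarIter L (k + 1) (flat (d := d) (n := n)) Y' z κ‖ := by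
        refine add_le_add hcomm ?_
        rw [norm_smul, Real.norm_eq_abs]
        exact mul_le_mul_of_nonneg_right hχ1 (norm_nonneg _)
    _ ≤ _ := by rw [one_mul]; exact add_le_add le_rfl hcurv

include hL in
omit [Nonempty n] in
/-- **(C2) OFF THE SUPPORT**: where `χ(M•z) = 0` the straight datum is the commutator alone — if `|χ| ≤ ω` on the straight-average region of `(z, κ)` then
`‖QbarIter L (k+1) flat (χ•F) z κ‖ ≤ M·(ω·S)` for ANY `F` with `‖F‖ ≤ S` (no background, no gauge, no near-flatness). [folklore] -/
theorem local_straight_datum_letter_off_support (F : Site d → Fin d → Matrix n n ℂ) (χ : Site d → ℝ) (z : Site d) (κ : Fin d)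
    {S ω : ℝ} (hS : ∀ y μ, ‖F y μ‖ ≤ S)
    (hω : ∀ x' : Site d, (((L ^ (k + 1) : ℕ) : ℤ) • z) ≤ x' → (∀ i, i ≠ κ → x' i ≤ ((((L ^ (k + 1) : ℕ) : ℤ) • z) i) + (((L ^ (k + 1) : ℕ) : ℤ) - 1)) →
      x' κ ≤ ((((L ^ (k + 1) : ℕ) : ℤ) • z) κ) + 2 * (((L ^ (k + 1) : ℕ) : ℤ) - 1) → |χ x'| ≤ ω) :
    ‖QbarIter L (k + 1) (flat (d := d) (n := n)) (fun y μ => χ y • F y μ) z κ‖ ≤ ((L ^ (k + 1) : ℕ) : ℝ) * (ω * S) := by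
  have hL1 : 1 ≤ L := le_trans one_le_two hL
  have h := cutoff_commutator_flat hL1 k χ 0 F z κ hS (fun x' h1 h2 h3 => by rw [sub_zero]; exact hω x' h1 h2 h3)
  rwa [zero_smul, sub_zero] at h

end Assembled

/-! ## §4 (v2 APPEND) The oscillation from a sup-step Lipschitz bound — the shape of `AveragingDeficitLatticeH2Prep.abs_chi_sub_chi_le_of_step` -/

section SupStep

omit [Fintype n] [DecidableEq n]

/-- **A SUP-STEP LIPSCHITZ FUNCTION IS LIPSCHITZ FOR THE `ℓ^∞` DISTANCE**: if `|χ x′ − χ x| ≤ g` whenever every coordinate of `x′ − x` is in `[−1, 1]`, then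
`|χ x − χ y| ≤ N·g` whenever every `|x_j − y_j| ≤ N` (walk from `y` to `x` by clamped unit steps). [folklore] -/
theorem abs_sub_le_mul_of_supStep (χ : Site d → ℝ) {g : ℝ}
    (hstep : ∀ x x' : Site d, (∀ j, |x' j - x j| ≤ 1) → |χ x' - χ x| ≤ g) :
    ∀ (N : ℕ) (x y : Site d), (∀ j, |x j - y j| ≤ (N : ℤ)) → |χ x - χ y| ≤ (N : ℝ) * g := by
  intro N
  induction N with
  | zero =>
      intro x y h
      have hxy : x = y := funext fun j => by
        have hj := h j
        rw [Nat.cast_zero, abs_nonpos_iff, sub_eq_zero] at hj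
        exact hj
      rw [hxy, sub_self, abs_zero, Nat.cast_zero, zero_mul]
  | succ N ih =>
      intro x y h
      -- one clamped step from `y` towards `x`
      let y' : Site d := fun j => y j + max (-1) (min 1 (x j - y j))
      have hstep' : ∀ j, |y' j - y j| ≤ 1 := fun j => by
        show |y j + max (-1) (min 1 (x j - y j)) - y j| ≤ 1
        rw [add_sub_cancel_left, abs_le]
        constructor <;> omega
      have hrest : ∀ j, |x j - y' j| ≤ (N : ℤ) := fun j => by
        have hj := abs_le.mp (h j)
        show |x j - (y j + max (-1) (min 1 (x j - y j)))| ≤ (N : ℤ)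
        rw [abs_le]
        push_cast at hj ⊢
        constructor <;> omega
      have h1 : |χ x - χ y'| ≤ (N : ℝ) * g := ih x y' hrest
      have h2 : |χ y' - χ y| ≤ g := hstep y y' hstep'
      calc |χ x - χ y| ≤ |χ x - χ y'| + |χ y' - χ y| := abs_sub_le _ _ _
        _ ≤ (N : ℝ) * g + g := add_le_add h1 h2
        _ = ((N + 1 : ℕ) : ℝ) * g := by push_cast; ring

/-- **THE OSCILLATION ON THE STRAIGHT-AVERAGE REGION** (`M ≥ 1`): a sup-step `g`-Lipschitz `χ` moves by at most `2(M−1)·g` between the block corner `M•z` and any point of the region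
`M•z ≤ x′`, `x′_i ≤ M z_i + (M−1)` (`i ≠ κ`), `x′_κ ≤ M z_κ + 2(M−1)`. [folklore] -/
theorem osc_region_of_supStep (χ : Site d → ℝ) {g : ℝ}
    (hstep : ∀ x x' : Site d, (∀ j, |x' j - x j| ≤ 1) → |χ x' - χ x| ≤ g) {M : ℕ} (hM : 1 ≤ M) (z : Site d) (κ : Fin d)
    (x' : Site d) (h1 : ((M : ℤ) • z) ≤ x') (h2 : ∀ i, i ≠ κ → x' i ≤ ((M : ℤ) • z) i + ((M : ℤ) - 1))
    (h3 : x' κ ≤ ((M : ℤ) • z) κ + 2 * ((M : ℤ) - 1)) :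
    |χ x' - χ ((M : ℤ) • z)| ≤ (((2 * (M - 1) : ℕ)) : ℝ) * g := by
  refine abs_sub_le_mul_of_supStep χ hstep (2 * (M - 1)) x' ((M : ℤ) • z) fun j => ?_
  have hlo : ((M : ℤ) • z) j ≤ x' j := h1 j
  have hcast : (((2 * (M - 1) : ℕ)) : ℤ) = 2 * ((M : ℤ) - 1) := by push_cast [Nat.cast_sub hM]; ring
  rw [hcast, abs_le]
  by_cases hj : j = κ
  · subst hj; constructor <;> linarith
  · have := h2 j hj; constructor <;> linarith

end SupStep

section AssembledSupStep

variable [Nonempty n] {L : ℕ} (hL : 2 ≤ L) (k : ℕ) {W : Site d → Fin d → (Matrix n n ℂ)ˣ} {x : ℝ}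
  (hWu : IsUnitaryCfg W) (hx : 0 ≤ x) (hs : LevelSmall d L k x) (hWx : SmallField W x)
  {u : Site d → (Matrix n n ℂ)ˣ} (hu : ∀ y, u y ∈ unitaryUnits (Matrix n n ℂ))

include hL hWu hx hs hWx hu in
/-- **(C2) WITH A SUP-STEP LIPSCHITZ CUT-OFF** (e.g. `χ := AveragingDeficitLatticeH2Prep.chi R M′ z₀`, `g = 1∕M′` by `abs_chi_sub_chi_le_of_step`; `M = L^{k+1}`): under the hypotheses of
`local_straight_datum_letter` with `hω` replaced by `|χ x′ − χ x| ≤ g` for sup-unit steps,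
`‖QbarIter L (k+1) flat (χ•Y′) z κ‖ ≤ M·(2(M−1)·g·S) + 2L^k·S·Σ_{i<k+1}((2d+4)L²·δ_i + (8L + C_sup)·loopRad d L (x_i))`. [folklore] -/
theorem local_straight_datum_letter_of_supStep (Y : Site d → Fin d → Matrix n n ℂ) (χ : Site d → ℝ) (z : Site d) (κ : Fin d)
    (hY0 : QbarIter L (k + 1) W Y z κ = 0) {S g δ : ℝ} (hS0 : 0 ≤ S) (hS : ∀ y μ, ‖Y y μ‖ ≤ S)
    (hχ1 : |χ (((L ^ (k + 1) : ℕ) : ℤ) • z)| ≤ 1)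
    (hstep : ∀ x₁ x₂ : Site d, (∀ j, |x₂ j - x₁ j| ≤ 1) → |χ x₂ - χ x₁| ≤ g)
    (hδ : ∀ (x' : Site d) (μ : Fin d), l1 (x' - ((L : ℤ) ^ (k + 1)) • z) ≤ nbRad d L * ∑ i ∈ Finset.range (k + 1), L ^ i →
      ‖((gaugeAct u W x' μ : (Matrix n n ℂ)ˣ) : Matrix n n ℂ) - 1‖ ≤ δ) :
    ‖QbarIter L (k + 1) (flat (d := d) (n := n)) (fun y μ => χ y • Ad (u (y + e μ)) (Y y μ)) z κ‖
      ≤ ((L ^ (k + 1) : ℕ) : ℝ) * ((((2 * (L ^ (k + 1) - 1) : ℕ)) : ℝ) * g * S)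
        + (L : ℝ) ^ k * (2 * S) * ∑ i ∈ Finset.range (k + 1),
          ((2 * (d : ℝ) + 4) * (L : ℝ) ^ 2 * ((L : ℝ) ^ i * δ + 4 * ∑ i' ∈ Finset.range i, (L : ℝ) ^ (i - 1 - i') * loopRad d L ((prop1Radius d L)^[i'] x))
            + (8 * (L : ℝ) + Csup d L) * loopRad d L ((prop1Radius d L)^[i] x)) := by
  have hM : 1 ≤ L ^ (k + 1) := Nat.one_le_pow _ _ (le_trans one_le_two hL)
  have hω := fun x' h1 h2 h3 => osc_region_of_supStep χ hstep hM z κ x' h1 h2 h3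
  have h := local_straight_datum_letter hL k hWu hx hs hWx hu Y χ z κ hY0 hS0 hS hχ1 (ω := (((2 * (L ^ (k + 1) - 1) : ℕ)) : ℝ) * g)
    (fun x' h1 h2 h3 => by
      have := hω x' h1 h2 h3
      push_cast at this h1 h2 h3 ⊢
      exact this) hδ
  simpa only [mul_assoc] using h

end AssembledSupStep

end

end Summit.QuantumFields.BalabanUV.T4Continuum.NE7LocalStraightDatumLetter
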